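import Mathlib
import Literature.NumberTheory.Automorphic.GaussCellGL

/-!
# `LU` from non-vanishing leading principal minors — stub `stub_lu_of_leadMinor_ne_zero`
(line `Sketch`, crux `GLnSeparatingDesigns.BorderHalfDimensionDesigns`, stmt-MatrixMultiplication-18360)

A complex `n × n` matrix `A` whose leading principal minors of sizes `0, …, n-1` are non-zero
(`leadMinor Fin.castSucc A (Fin.castSucc j) ≠ 0`, the determinant of the block `{i | i < j}²`)
factors as `A = m · u` with `m` lower triangular and `u` upper unitriangular. No invertibility of
`A` is needed (the last pivot may vanish; it sits in `m`).

Proof: everything is the Gauss-cell vocabulary of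
`Literature/NumberTheory/Automorphic/GaussCellGL.lean` with the injective weight function
`b = Fin.castSucc : Fin n → Fin (n+1)`. The normalised Cramer candidate `S₁ = gaussS₁ b A` is
block upper unipotent (`isBlockUpperUnipotent_gaussS₁`, hypothesis literally `hA`), hence so is
`S₁⁻¹` (`IsBlockUpperUnipotent.inv`) and `det S₁ = 1` (`IsBlockUpperUnipotent.det_eq_one`), while
`A · S₁` is block lower triangular (`mul_gaussS₁_blockTriangular`). Take `m = A · S₁`,
`u = S₁⁻¹`; then `m · u = A · S₁ · S₁⁻¹ = A` (`Matrix.mul_nonsing_inv_cancel_right`).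
-/

-- single-problem summit: the mandated namespace repeats `MatrixMultiplication`.
set_option linter.dupNamespace false

namespace Summit.MatrixMultiplication.MatrixMultiplication.Theorems.BorderHalfDimensionDesigns

open Matrix OrderDual
open Literature.NumberTheory.Automorphic

/-- **`LU` decomposition from non-vanishing leading principal minors.** If the leading principal
minors of sizes `0, …, n-1` of `A : Matrix (Fin n) (Fin n) ℂ` are non-zero, then `A = m * u` with
`m` lower triangular (block triangular for `toDual ∘ Fin.castSucc`), `u` upper triangular (block
triangular for `Fin.castSucc`) with unit diagonal. Witnesses: `m = A * gaussS₁ Fin.castSucc A`,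
`u = (gaussS₁ Fin.castSucc A)⁻¹`. [folklore] -/
theorem stub_lu_of_leadMinor_ne_zero {n : ℕ} (A : Matrix (Fin n) (Fin n) ℂ)
    (hA : ∀ j : Fin n, Literature.NumberTheory.Automorphic.leadMinor Fin.castSucc A (Fin.castSucc j) ≠ 0) :
    ∃ m u : Matrix (Fin n) (Fin n) ℂ,
      m.BlockTriangular (fun i : Fin n => OrderDual.toDual (Fin.castSucc i)) ∧
      u.BlockTriangular Fin.castSucc ∧ (∀ i, u i i = 1) ∧ A = m * u := by
  have hS : IsBlockUpperUnipotent Fin.castSucc (gaussS₁ Fin.castSucc A) :=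
    isBlockUpperUnipotent_gaussS₁ hA
  have hdet : IsUnit (gaussS₁ Fin.castSucc A).det := by
    rw [hS.det_eq_one]
    exact isUnit_one
  refine ⟨A * gaussS₁ Fin.castSucc A, (gaussS₁ Fin.castSucc A)⁻¹,
    mul_gaussS₁_blockTriangular (b := Fin.castSucc) A, hS.inv.1, fun i => ?_, ?_⟩
  · rw [hS.inv.2 i i rfl, Matrix.one_apply_eq]
  · rw [Matrix.mul_nonsing_inv_cancel_right _ _ hdet]

end Summit.MatrixMultiplication.MatrixMultiplication.Theorems.BorderHalfDimensionDesigns
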